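import Mathlib
import HarnessLib
import Summits.Ventures.LatticeQCDFlow.Exactness.NCMCGeneralSpaceReplicaProductChainTStatistic
import Summits.Ventures.LatticeQCDFlow.Exactness.NCMCGeneralSpaceReplicaJackknifeRatio
import Summits.Ventures.LatticeQCDFlow.Exactness.NCMCGeneralSpaceRestartChainVarianceDichotomyLanes
import Summits.Ventures.LatticeQCDFlow.Exactness.NCMCGeneralSpaceRestartChainEveryStart
import Summits.Ventures.LatticeQCDFlow.Exactness.NCMCGeneralSpaceEstimatorConsistency
import Summits.Ventures.LatticeQCDFlow.Exactness.NCMCGeneralSpaceIndicatorCLT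
import Summits.Ventures.LatticeQCDFlow.Scoring.MultivariateDeltaMethod

/-!
# The engine's POOLED `reweighted_mean ± q·err` over streams with a DEPENDENT joint start (the product restart chain): coverage `→ L_R(q)`

HONEST FRAMING: exact (Metropolis-corrected) sampling algorithms for lattice gauge theory;
figures of merit are autocorrelation/cost numbers at stated couplings and volumes; no
continuum-physics claim.

Venture `LatticeQCDFlow` (cell pub-lqcd), topic `Exactness`; FANOUT row 13 (`eng-snf`, GEN-26).
NEW WORK of the cell (elementary asymptotic statistics): the dependent-start companion of GEN-25's
`NCMCGeneralSpaceReplicaReweightedPooledJackknife` (independent streams).  Composition of GEN-24 D3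
`NCMCGeneralSpaceReplicaProductChainTStatistic` (`tendstoInDistribution_replicaVector_productChain`: the
replica VECTOR of the product chain converges to the product Gaussian from EVERY joint initial law),
GEN-25 G25-2 `NCMCGeneralSpaceReplicaJackknifeRatio` (`tendsto_measure_abs_pooledRatioJackknife_le`),
GEN-23 V2 `reweightVariance_pos_iff`, the reweighting identity `integral_exp_neg_work_mul_comp_end`,
and row 4's `Scoring.tendstoInMeasure_of_tendstoInDistribution_smul` (a CLT-scaled sequence is
consistent).  Not a published result; no definition; nothing cited as a fact.

WHY (row 13).  `estimators.reweighted_mean` run on the concatenated records of `R` streams with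
`block_ids` = stream labels prints the POOLED ratio `Σ e^{−W} f∘e / Σ e^{−W}` and its delete-one-stream
jackknife `err`.  GEN-25 settled its coverage for INDEPENDENT streams; here the `R` streams start from
ANY joint law `μ` on `ι → E` — typically all branched off ONE equilibration run — and are then
advanced independently, stream `r` by its own restart chain `(κF ∘ₖ K).comap s` (row 9's product
kernel `replicaSweep`).  The two inputs of the pooled-ratio theorem survive the dependence: (i) the
vector of scaled block means of the centred record observable `c = e^{−W}(f∘e − μ_f)` (bounded,
`E_F c = 0`) converges to `N(0, σ²_c)^{⊗R}` by D3; (ii) each stream's mean weight converges in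
probability to `Z₁/Z₀ > 0` — read off D3's vector limit for the weight itself (coordinate projection,
then `√n → ∞` forces consistency).  Hence, with `Z₀, Z₁ ≠ 0`, `−B ≤ W`, `|f| ≤ C_f`, `0 < ∫ c² dP_F`,
`K` Markov `ν₀`-invariant dominating a finite non-zero `m`: for every bias-correction weight `κ'` and
every `q ≥ 0`, `P(|pooled + κ'(pooled − m) − μ_f| ≤ q·err) → L_R(q) = N(0,1)^{⊗R}{|t| ≤ q}`,
`μ_f = Z₁⁻¹ ∫ f dν₁`, from EVERY joint start.

* **`CrooksPair.tendsto_measure_abs_pooledReweightedJackknife_le_productChain`**.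

NOT CLAIMED: interacting streams; unbounded work or observable; unequal stream lengths; contiguous
blocks of ONE stream; rates; anything numerical.
-/

namespace Summit.Ventures.LatticeQCDFlow.Exactness.GeneralNCMC

open MeasureTheory ProbabilityTheory Set Filter Finset Function WithLp
open Summit.Ventures.LatticeQCDFlow.Exactness
open scoped ENNReal NNReal Topology

variable {Ω E : Type*} [MeasurableSpace Ω] [MeasurableSpace E]

/-- `√n (A/n − θ·B/n) = (√n)⁻¹ (A − θ B)` (both sides vanish at `n = 0`).  (Private copy of the
identity of `NCMCGeneralSpaceReplicaReweightedPooledJackknife`, which is not imported here.) -/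
private theorem sqrt_mul_div_sub_mul_div_eq_aux (A B θ : ℝ) (n : ℕ) :
    Real.sqrt (n : ℝ) * (A / n - θ * (B / n)) = (Real.sqrt (n : ℝ))⁻¹ * (A - θ * B) := by
  rcases Nat.eq_zero_or_pos n with hn | hn
  · subst hn; simp
  · have h1 : Real.sqrt (n : ℝ) * (A / n - θ * (B / n)) = Real.sqrt (n : ℝ) / n * (A - θ * B) := by
      ring
    rw [h1, Real.sqrt_div_self', one_div]

namespace CrooksPair

variable {ν₀ ν₁ : Measure Ω} [IsFiniteMeasure ν₀] [IsFiniteMeasure ν₁] {κF κR : Kernel Ω E}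
  [IsMarkovKernel κF] [IsMarkovKernel κR] {s e : E → Ω} {W : E → ℝ}
  {ι : Type*} [Fintype ι] [DecidableEq ι] [Nontrivial ι]

/-- **THE ENGINE'S POOLED `reweighted_mean (+ κ'·(mean − m)) ± q·err` OVER `R ≥ 2` STREAMS WITH A
DEPENDENT JOINT START HAS LIMITING COVERAGE `L_R(q)`.**  Crooks pair with `Z₀, Z₁ ≠ 0`, `−B ≤ W`,
`f` measurable with `|f| ≤ C_f`, `0 < ∫ (e^{−W}(f∘e − μ_f))² dP_F`; `K` Markov, `ν₀`-invariant,
`m ≤ K(z, ·)` for all `z` (`m` finite, non-zero); the record streams start from ANY joint law `μ` on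
`ι → E` and are advanced independently, stream `r` by its own restart chain (product kernel
`replicaSweep`, duplicate-free list `L` of all streams); `κ'` real, `q ≥ 0`. -/
theorem tendsto_measure_abs_pooledReweightedJackknife_le_productChain (K : Kernel Ω Ω)
    [IsMarkovKernel K] (h0 : ν₀ univ ≠ 0) (h1 : ν₁ univ ≠ 0) (hK : Kernel.Invariant K ν₀)
    (h : CrooksPair ν₀ ν₁ κF κR s e W) {m : Measure Ω} [IsFiniteMeasure m] (hm0 : m univ ≠ 0)
    (hmin : ∀ z, m ≤ K z) {B : ℝ} (hB : ∀ ω, -B ≤ W ω) {f : Ω → ℝ} (hfm : Measurable f) {Cf : ℝ}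
    (hCf : ∀ y, |f y| ≤ Cf)
    (hV : 0 < ∫ ω, (Real.exp (-W ω) * (f (e ω) - ((ν₁ univ)⁻¹).toReal * ∫ y, f y ∂ν₁)) ^ 2
      ∂(fwdPathLaw ν₀ κF))
    {L : List ι} (hL : L.Nodup) (hLall : ∀ r, r ∈ L)
    (μ : Measure (ι → E)) [IsProbabilityMeasure μ]
    [IsProbabilityMeasure (Kernel.trajMeasure (X := fun _ : ℕ => ι → E) μ
        (fun n : ℕ => (replicaSweep (fun _ : ι => (κF ∘ₖ K).comap s h.measurable_s) L).comap
          (fun hh : (i : ↥(Finset.Iic n)) → ι → E => hh ⟨n, Finset.mem_Iic.2 le_rfl⟩)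
          (measurable_pi_apply _)))] (κ' : ℝ) {q : ℝ} (hq : 0 ≤ q) :
    Tendsto (fun n : ℕ => (Kernel.trajMeasure (X := fun _ : ℕ => ι → E) μ
        (fun n : ℕ => (replicaSweep (fun _ : ι => (κF ∘ₖ K).comap s h.measurable_s) L).comap
          (fun hh : (i : ↥(Finset.Iic n)) → ι → E => hh ⟨n, Finset.mem_Iic.2 le_rfl⟩)
          (measurable_pi_apply _)))
        {x : ℕ → ι → E |
          |((∑ r, ∑ i ∈ range n, Real.exp (-W (x i r)) * f (e (x i r)))
                / (∑ r, ∑ i ∈ range n, Real.exp (-W (x i r)))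
              + κ' * ((∑ r, ∑ i ∈ range n, Real.exp (-W (x i r)) * f (e (x i r)))
                  / (∑ r, ∑ i ∈ range n, Real.exp (-W (x i r)))
                - (∑ t, (∑ r ∈ univ.erase t, ∑ i ∈ range n, Real.exp (-W (x i r)) * f (e (x i r)))
                    / (∑ r ∈ univ.erase t, ∑ i ∈ range n, Real.exp (-W (x i r))))
                  / Fintype.card ι)
              - ((ν₁ univ)⁻¹).toReal * ∫ y, f y ∂ν₁)
            / Real.sqrt (((Fintype.card ι : ℝ) - 1) / Fintype.card ι
              * ∑ r, ((∑ u ∈ univ.erase r, ∑ i ∈ range n, Real.exp (-W (x i u)) * f (e (x i u)))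
                    / (∑ u ∈ univ.erase r, ∑ i ∈ range n, Real.exp (-W (x i u)))
                - (∑ t, (∑ u ∈ univ.erase t, ∑ i ∈ range n, Real.exp (-W (x i u)) * f (e (x i u)))
                    / (∑ u ∈ univ.erase t, ∑ i ∈ range n, Real.exp (-W (x i u))))
                  / Fintype.card ι) ^ 2)| ≤ q})
      atTop
      (𝓝 ((Measure.pi fun _ : ι => gaussianReal 0 1) {z : ι → ℝ | |(∑ r, z r) / Fintype.card ι
        / Real.sqrt ((∑ r, (z r - (∑ r', z r') / Fintype.card ι) ^ 2)
            / ((Fintype.card ι : ℝ) * (Fintype.card ι - 1)))| ≤ q})) := by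
  haveI := isProbabilityMeasure_fwdPathLaw ν₀ h0 κF
  haveI := isProbabilityMeasure_normalised_bind_kernel κF hm0
  set Rk := (κF ∘ₖ K).comap s h.measurable_s with hRk
  set P : Measure (ℕ → ι → E) := Kernel.trajMeasure (X := fun _ : ℕ => ι → E) μ
    (fun n : ℕ => (replicaSweep (fun _ : ι => Rk) L).comap
      (fun hh : (i : ↥(Finset.Iic n)) → ι → E => hh ⟨n, Finset.mem_Iic.2 le_rfl⟩)
      (measurable_pi_apply _)) with hP
  set θZ : ℝ := ((ν₀ univ)⁻¹ * ν₁ univ).toReal with hθZ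
  set μf : ℝ := ((ν₁ univ)⁻¹).toReal * ∫ y, f y ∂ν₁ with hμf
  have hθZpos : 0 < θZ :=
    ENNReal.toReal_pos (mul_ne_zero (ENNReal.inv_ne_zero.2 (measure_ne_top ν₀ univ)) h1)
      (ENNReal.mul_ne_top (ENNReal.inv_ne_top.2 h0) (measure_ne_top ν₁ univ))
  have hπ : Kernel.Invariant Rk (fwdPathLaw ν₀ κF) := h.invariant_restartKernel K hK
  -- one-step minorisation of the restart kernel by the probability measure `(m(Ω))⁻¹ m ∘ κF`
  have hmin' : ∀ z, m univ • ((m univ)⁻¹ • m.bind κF) ≤ Rk z := fun z => by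
    have hz := restartKernel_nHit_one_minorised K h hm0 hmin z
    rwa [nHit_one] at hz
  -- the weight and the centred reweighting observable: measurable, bounded
  have hwm : Measurable fun ε => Real.exp (-W ε) := Real.measurable_exp.comp h.measurable_W.neg
  have hwC : ∀ ω, |Real.exp (-W ω)| ≤ Real.exp B := fun ω => by
    rw [abs_of_pos (Real.exp_pos _)]
    exact Real.exp_le_exp.2 (by linarith [hB ω])
  have hwint : ∫ z, Real.exp (-W z) ∂(fwdPathLaw ν₀ κF) = θZ := h.integral_exp_neg_work
  have hcm : Measurable fun ω => Real.exp (-W ω) * (f (e ω) - μf) :=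
    hwm.mul ((hfm.comp h.measurable_e).sub measurable_const)
  have hcb : ∀ ω, |Real.exp (-W ω) * (f (e ω) - μf)| ≤ Real.exp B * (Cf + |μf|) := fun ω => by
    rw [abs_mul, abs_of_pos (Real.exp_pos _)]
    exact mul_le_mul (Real.exp_le_exp.2 (by linarith [hB ω]))
      ((abs_sub _ _).trans (add_le_add (hCf _) le_rfl)) (abs_nonneg _) (Real.exp_pos _).le
  have hc0 : ∫ ω, Real.exp (-W ω) * (f (e ω) - μf) ∂(fwdPathLaw ν₀ κF) = 0 := by
    have key := h.integral_exp_neg_work_mul_comp_end (f := fun y => f y - μf)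
      (hfm.sub measurable_const).aestronglyMeasurable
    have hint : ∫ y, (f y - μf) ∂ν₁ = ∫ y, f y ∂ν₁ - ν₁.real univ * μf := by
      rw [integral_sub (Scoring.integrable_of_bounded ν₁ hfm hCf) (integrable_const _),
        integral_const, smul_eq_mul]
    rw [key, hint, hμf, measureReal_def]
    simp only [ENNReal.toReal_inv]
    have hz : (ν₁ univ).toReal ≠ 0 := ENNReal.toReal_ne_zero.2 ⟨h1, measure_ne_top _ _⟩
    field_simp
    ring
  -- the Green–Kubo variance of `c` along the restart chain is positive (variance dichotomy)
  have hσ : 0 < Scoring.autocov Rk (fwdPathLaw ν₀ κF)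
        (fun ω => Real.exp (-W ω) * (f (e ω) - μf)
          - ∫ z, Real.exp (-W z) * (f (e z) - μf) ∂(fwdPathLaw ν₀ κF)) 0
      + 2 * ∑' t, Scoring.autocov Rk (fwdPathLaw ν₀ κF)
        (fun ω => Real.exp (-W ω) * (f (e ω) - μf)
          - ∫ z, Real.exp (-W z) * (f (e z) - μf) ∂(fwdPathLaw ν₀ κF)) (t + 1) := by
    refine (h.reweightVariance_pos_iff K h0 hK hm0 hmin hB hfm hCf).2 ?_
    show 0 < ∫ ω, (Real.exp (-W ω) * (f (e ω) - μf)
      - ∫ z, Real.exp (-W z) * (f (e z) - μf) ∂(fwdPathLaw ν₀ κF)) ^ 2 ∂(fwdPathLaw ν₀ κF)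
    simpa only [hc0, sub_zero] using hV
  have hv : Real.toNNReal (Scoring.autocov Rk (fwdPathLaw ν₀ κF)
        (fun ω => Real.exp (-W ω) * (f (e ω) - μf)
          - ∫ z, Real.exp (-W z) * (f (e z) - μf) ∂(fwdPathLaw ν₀ κF)) 0
      + 2 * ∑' t, Scoring.autocov Rk (fwdPathLaw ν₀ κF)
        (fun ω => Real.exp (-W ω) * (f (e ω) - μf)
          - ∫ z, Real.exp (-W z) * (f (e z) - μf) ∂(fwdPathLaw ν₀ κF)) (t + 1)) ≠ 0 := by
    rw [ne_eq, Real.toNNReal_eq_zero, not_le]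
    exact hσ
  -- (i) the replica VECTOR of scaled block means of `c` along the product chain (D3)
  have hvec0 := tendstoInDistribution_replicaVector_productChain hπ hm0 hmin' hL hLall hcm hcb μ
  have hvec : TendstoInDistribution (fun (n : ℕ) (x : ℕ → ι → E) =>
        toLp 2 (fun r => Real.sqrt (n : ℝ)
          * ((∑ i ∈ range n, Real.exp (-W (x i r)) * f (e (x i r))) / n
            - μf * ((∑ i ∈ range n, Real.exp (-W (x i r))) / n))))
      atTop (toLp 2) (fun _ => P) (Measure.pi fun _ : ι => gaussianReal 0 (Real.toNNReal
        (Scoring.autocov Rk (fwdPathLaw ν₀ κF)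
          (fun ω => Real.exp (-W ω) * (f (e ω) - μf)
            - ∫ z, Real.exp (-W z) * (f (e z) - μf) ∂(fwdPathLaw ν₀ κF)) 0
        + 2 * ∑' k, Scoring.autocov Rk (fwdPathLaw ν₀ κF)
          (fun ω => Real.exp (-W ω) * (f (e ω) - μf)
            - ∫ z, Real.exp (-W z) * (f (e z) - μf) ∂(fwdPathLaw ν₀ κF)) (k + 1)))) := by
    refine hvec0.congr (fun n => Eventually.of_forall fun x => ?_) Filter.EventuallyEq.rfl
    congr 1
    funext r
    rw [hc0, sqrt_mul_div_sub_mul_div_eq_aux]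
    congr 1
    rw [Finset.mul_sum, ← Finset.sum_sub_distrib]
    exact Finset.sum_congr rfl fun i _ => by ring
  -- (ii) each stream's mean weight converges in probability to `Z₁/Z₀` (from D3's vector limit)
  have hvecW := tendstoInDistribution_replicaVector_productChain hπ hm0 hmin' hL hLall hwm hwC μ
  have hYm1 : ∀ n : ℕ, Measurable fun (x : ℕ → ι → E) (r : ι) =>
      (∑ i ∈ range n, Real.exp (-W (x i r))) / n := fun n =>
    measurable_pi_lambda _ fun r => (Finset.measurable_sum _ fun i _ =>
      hwm.comp ((measurable_pi_apply r).comp (measurable_pi_apply i))).div_const _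
  have hYb : ∀ r : ι, TendstoInMeasure P
      (fun (n : ℕ) (x : ℕ → ι → E) => (∑ i ∈ range n, Real.exp (-W (x i r))) / n)
      atTop (fun _ => θZ) := by
    intro r
    have hr := hvecW.continuous_comp (PiLp.continuous_apply 2 (fun _ : ι => ℝ) r)
    refine Scoring.CardConsistency.tendstoInMeasure_of_tendstoInDistribution_smul
      (a := fun n : ℕ => Real.sqrt (n : ℝ))
      (Real.tendsto_sqrt_atTop.comp tendsto_natCast_atTop_atTop)
      (hr.congr (fun n => Eventually.of_forall fun x => ?_) Filter.EventuallyEq.rfl)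
    simp only [Function.comp_apply, smul_eq_mul, hwint]
    exact (sqrt_mul_mean_sub_eq (fun i => Real.exp (-W (x i r))) θZ n).symm
  -- the pooled-ratio jackknife theorem
  have hmain := tendsto_measure_abs_pooledRatioJackknife_le (P := P)
    (X := fun (n : ℕ) (x : ℕ → ι → E) (r : ι) =>
      (∑ i ∈ range n, Real.exp (-W (x i r)) * f (e (x i r))) / n)
    (Y := fun (n : ℕ) (x : ℕ → ι → E) (r : ι) => (∑ i ∈ range n, Real.exp (-W (x i r))) / n)
    hYm1
    (fun n x r hn => div_pos (sum_pos (fun i _ => Real.exp_pos _)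
      (Finset.nonempty_range_iff.2 (Nat.pos_iff_ne_zero.1 hn))) (by exact_mod_cast hn))
    (θ := μf) hθZpos.ne' hv hvec hYb κ' hq
  -- sums of block means over streams are the pooled sums over all records, up to the factor `n`
  refine hmain.congr' ?_
  filter_upwards [eventually_gt_atTop 0] with n hn
  have hn' : (n : ℝ) ≠ 0 := by exact_mod_cast hn.ne'
  congr 1
  ext x
  simp only [Set.mem_setOf_eq, ← Finset.sum_div, div_div_div_cancel_right₀ hn']

end CrooksPair

end Summit.Ventures.LatticeQCDFlow.Exactness.GeneralNCMC
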